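import Summits.ResolutionOfSingularities.ResolutionOfSingularities.Theorems.FrobeniusLadderFInjectiveMacaulayficationDegreeZeroDescentLocal
import Mathlib.AlgebraicGeometry.Morphisms.FiniteType
import Mathlib.AlgebraicGeometry.AffineScheme
import HarnessLib

/-!
# Openness of the F-injective locus: the ring-to-scheme transport (crux `FInjectiveMacaulayfication`, stub #2)

Support file for crux stmt-ResolutionOfSingularities-15315
(`FrobeniusLadder.FInjectiveMacaulayfication`, registered skeleton `10f06f91`, line `Sketch`; the
ISOLATION sub-skeleton §3a). Registered stub #2 `stub_fiLocusOpen` says: on a scheme `X₁` locally of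
finite type over a field `k` of characteristic `p` all of whose stalks are Cohen–Macaulay (every system of
parameters weakly regular), the set of points `x` at which every parameter ideal of `𝒪_{X₁,x}` is Frobenius
closed (inline form `y^(p^e) ∈ span {z^(p^e) | z ∈ (s)} ⇒ y ∈ (s)`) is OPEN. Mathematically this is the
theorem in print "the F-injective locus of a ring of finite type over a field is open" (Datta–Murayama,
Math. Res. Lett. 31 (2024), Thm. B, with `A = k`) read through "a Cohen–Macaulay local ring is F-injective
iff every (iff one) parameter ideal is Frobenius closed" (loc. cit. Lem. 2.6, after Fedder–Watanabe and
Quy–Shimomoto) — a RING-LEVEL statement about `Spec R`. This file is the bookkeeping that reduces the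
SCHEME-LEVEL stub to that ring-level statement, so that #2 closes the moment the ring-level fact is
available (as a Literature named fact or a proof):

* §1 `fClause_of_ringEquiv`, `cmClause_of_ringEquiv` — the Frobenius-closure clause and the
  Cohen–Macaulay clause (inline forms, separately) transport along ring isomorphisms.
* §2 `isOpen_setOf_stalk_of_affineOpens` — LOCALITY: for any property `C` of commutative rings invariant
  under ring isomorphisms, if on every affine open `U` of a scheme `X` the set of primes `P` of `Γ(X, U)`
  with `C (Γ(X, U)_P)` is open in `Spec Γ(X, U)`, then `{x ∈ X | C (𝒪_{X,x})}` is open (affine opens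
  form a basis; `U.fromSpec` is an open embedding with range `U`; `𝒪_{X, U.fromSpec P} ≅ Γ(X, U)_P`,
  Mathlib `IsAffineOpen.isLocalization_stalk'`).
* §3 `cmClause_localization_of_stalks` — on an affine open, the Cohen–Macaulay clause at all stalks gives
  it at every `Γ(X, U)_P`; `finiteType_sections` — for `f : X → Spec k` locally of finite type and `U`
  affine, `Γ(X, U)` is a `k`-algebra of finite type for the algebra structure
  `k ≅ Γ(Spec k, ⊤) → Γ(X, U)` (`Scheme.Hom.finiteType_appLE`, `Scheme.ΓSpecIso`).
* §4 `fiLocusOpen_of_ringLevel` — THE REDUCTION: the registered signature of `stub_fiLocusOpen` with ONE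
  extra hypothesis, the ring-level openness statement for finite type `k`-algebras with Cohen–Macaulay
  local rings (the shape in which the Datta–Murayama theorem will be cited).

No definition is declared; the clauses are written inline in the route file's vocabulary. Everything
here is folklore bookkeeping (Stacks 01I2 for the stalks of affine opens).
-/

-- single-problem summit: the doubled namespace component is forced
set_option linter.dupNamespace false

noncomputable section

namespace Summit.ResolutionOfSingularities.ResolutionOfSingularities.Theorems.FInjectiveMacaulayfication.FiLocusOpenOfAffine

open CategoryTheory AlgebraicGeometry TopologicalSpace RingTheory.Sequence
open Summit.ResolutionOfSingularities.ResolutionOfSingularities.Theorems.FInjectiveMacaulayfication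

/-! ## §1 Transport of the two clauses along ring isomorphisms -/

/-- The Frobenius-closure clause — "every ideal generated by a system of parameters (`d = dim A` elements
generating an ideal with maximal radical) is Frobenius closed for the exponent base `p` (inline form)" —
transports along a ring isomorphism `e : A ≃+* B` (pull the tuple and the membership back along `e.symm`).
[folklore] -/
-- adapted from `DegreeZeroDescent.inlineClause_of_ringEquiv` (file DegreeZeroDescentLocal) (there together with weak regularity)
theorem fClause_of_ringEquiv (p : ℕ) {A B : Type} [CommRing A] [CommRing B] (e : A ≃+* B)
    (h : ∀ d : ℕ, ringKrullDim A = d → ∀ s : Fin d → A, (Ideal.span (Set.range s)).radical.IsMaximal →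
      ∀ y : A, (∃ n : ℕ, y ^ p ^ n ∈ Ideal.span ((fun z : A => z ^ p ^ n) ''
        (Ideal.span (Set.range s) : Set A))) → y ∈ Ideal.span (Set.range s)) :
    ∀ d : ℕ, ringKrullDim B = d → ∀ s : Fin d → B, (Ideal.span (Set.range s)).radical.IsMaximal →
      ∀ y : B, (∃ n : ℕ, y ^ p ^ n ∈ Ideal.span ((fun z : B => z ^ p ^ n) ''
        (Ideal.span (Set.range s) : Set B))) → y ∈ Ideal.span (Set.range s) := by
  intro d hd s hmax
  have hdA : ringKrullDim A = d := by rw [ringKrullDim_eq_of_ringEquiv e, hd]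
  have hI := FRationalResolution.ClauseInvariance.span_range_symm_comp e s
  have hmaxA : (Ideal.span (Set.range (e.symm ∘ s))).radical.IsMaximal := by
    rw [hI, ← Ideal.comap_radical]
    exact Ideal.comap_isMaximal_of_equiv e
  rintro y ⟨n, hn⟩
  have hmem : e.symm y ^ p ^ n ∈ Ideal.span ((fun z : A => z ^ p ^ n) ''
      (Ideal.span (Set.range (e.symm ∘ s)) : Set A)) := by
    rw [hI]
    have h1 := FRationalResolution.ClauseInvariance.symm_mem_span_pow_image e p n
      (Ideal.span (Set.range s)) (y := y) (c := 1) (by rwa [one_mul])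
    rwa [map_one, one_mul] at h1
  have hy := h d hdA (e.symm ∘ s) hmaxA (e.symm y) ⟨n, hmem⟩
  rwa [hI, Ideal.mem_comap, RingEquiv.apply_symm_apply] at hy

/-- The Cohen–Macaulay clause — "every system of parameters of `A` is a weakly regular sequence" —
transports along a ring isomorphism `e : A ≃+* B`. [folklore] -/
-- adapted from `StubCmGlue.cmDomain_of_ringEquiv` (there together with the domain conjunct)
theorem cmClause_of_ringEquiv {A B : Type} [CommRing A] [CommRing B] (e : A ≃+* B)
    (h : ∀ d : ℕ, ringKrullDim A = d → ∀ s : Fin d → A, (Ideal.span (Set.range s)).radical.IsMaximal →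
      IsWeaklyRegular A (List.ofFn s)) :
    ∀ d : ℕ, ringKrullDim B = d → ∀ s : Fin d → B, (Ideal.span (Set.range s)).radical.IsMaximal →
      IsWeaklyRegular B (List.ofFn s) := by
  intro d hd s hmax
  have hdA : ringKrullDim A = d := by rw [ringKrullDim_eq_of_ringEquiv e, hd]
  have hI := FRationalResolution.ClauseInvariance.span_range_symm_comp e s
  have hmaxA : (Ideal.span (Set.range (e.symm ∘ s))).radical.IsMaximal := by
    rw [hI, ← Ideal.comap_radical]
    exact Ideal.comap_isMaximal_of_equiv e
  have h1 := DegreeZeroDescent.isWeaklyRegular_map_ringEquiv e (h d hdA (e.symm ∘ s) hmaxA)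
  have hl : (List.ofFn (e.symm ∘ s)).map e = List.ofFn s := by
    rw [List.map_ofFn]
    congr 1
    funext i
    exact e.apply_symm_apply (s i)
  rwa [hl] at h1

/-! ## §2 Locality: a stalk condition is open if it is open on the spectra of the affine opens -/

/-- **Locality of ring-theoretic stalk conditions.** Let `C` be a property of commutative rings invariant
under ring isomorphisms and `X` a scheme. If for every affine open `U ⊆ X` the set of primes `P` of
`Γ(X, U)` with `C (Γ(X, U)_P)` is open in `Spec Γ(X, U)`, then `{x ∈ X | C (𝒪_{X,x})}` is open: around
`x` choose an affine open `U` (`exists_isAffineOpen_mem_and_subset`); `U.fromSpec : Spec Γ(X, U) → X` is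
an open embedding with range `U` (`IsAffineOpen.range_fromSpec`), and for a prime `P` the stalk
`𝒪_{X, U.fromSpec P}` is a localization of `Γ(X, U)` at `P` (`IsAffineOpen.isLocalization_stalk'`), hence
ring-isomorphic to `Γ(X, U)_P` (`IsLocalization.algEquiv`); so the image of the open set of primes is an
open neighbourhood of `x` inside `{C}`. [folklore] -/
theorem isOpen_setOf_stalk_of_affineOpens (X : Scheme.{0}) (C : ∀ (A : Type) [CommRing A], Prop)
    (hC : ∀ (A B : Type) [CommRing A] [CommRing B], (A ≃+* B) → C A → C B)
    (h : ∀ (U : X.Opens) (hU : IsAffineOpen U),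
      IsOpen {P : PrimeSpectrum Γ(X, U) | C (Localization.AtPrime P.asIdeal)}) :
    IsOpen {x : X | C (X.presheaf.stalk x)} := by
  rw [isOpen_iff_forall_mem_open]
  intro x hx
  obtain ⟨U, hU, hxU, -⟩ :=
    exists_isAffineOpen_mem_and_subset (X := X) (x := x) (U := ⊤) (Opens.mem_top x)
  -- the stalk at `U.fromSpec P` is `Γ(X, U)_P`
  have key : ∀ P : PrimeSpectrum Γ(X, U),
      Nonempty (X.presheaf.stalk (hU.fromSpec P) ≃+* Localization.AtPrime P.asIdeal) := by
    intro P
    have hPU : hU.fromSpec P ∈ U := by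
      rw [← SetLike.mem_coe, ← hU.range_fromSpec]
      exact ⟨P, rfl⟩
    letI : Algebra Γ(X, U) (X.presheaf.stalk (hU.fromSpec P)) :=
      TopCat.Presheaf.algebra_section_stalk X.presheaf ⟨hU.fromSpec P, hPU⟩
    haveI : IsLocalization.AtPrime (X.presheaf.stalk (hU.fromSpec P)) P.asIdeal :=
      hU.isLocalization_stalk' P hPU
    exact ⟨(IsLocalization.algEquiv P.asIdeal.primeCompl (X.presheaf.stalk (hU.fromSpec P))
      (Localization.AtPrime P.asIdeal)).toRingEquiv⟩
  refine ⟨hU.fromSpec '' {P : PrimeSpectrum Γ(X, U) | C (Localization.AtPrime P.asIdeal)}, ?_,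
    hU.fromSpec.isOpenEmbedding.isOpenMap _ (h U hU), ?_⟩
  · -- the image lies in `{C}`
    rintro _ ⟨P, hP, rfl⟩
    obtain ⟨e⟩ := key P
    exact hC _ _ e.symm hP
  · -- `x` lies in the image: `x = U.fromSpec P` with `C (Γ(X, U)_P)` transported from the stalk
    have hxr : x ∈ Set.range hU.fromSpec := by
      rw [hU.range_fromSpec]
      exact hxU
    obtain ⟨P, rfl⟩ := hxr
    obtain ⟨e⟩ := key P
    exact ⟨P, hC _ _ e hx, rfl⟩

/-! ## §3 From the scheme to its affine opens -/

/-- On an affine open `U` of a scheme `X` all of whose stalks at points of `U` satisfy the Cohen–Macaulay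
clause, every local ring `Γ(X, U)_P` (`P` prime) satisfies it: `Γ(X, U)_P ≅ 𝒪_{X, U.fromSpec P}`
(`IsAffineOpen.isLocalization_stalk'`) and the clause transports (`cmClause_of_ringEquiv`). [folklore] -/
theorem cmClause_localization_of_stalks {X : Scheme.{0}} {U : X.Opens} (hU : IsAffineOpen U)
    (hCM : ∀ x : X, x ∈ U → ∀ d : ℕ, ringKrullDim (X.presheaf.stalk x) = d →
      ∀ s : Fin d → X.presheaf.stalk x, (Ideal.span (Set.range s)).radical.IsMaximal →
        IsWeaklyRegular (X.presheaf.stalk x) (List.ofFn s))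
    (P : Ideal Γ(X, U)) [hP : P.IsPrime] :
    ∀ d : ℕ, ringKrullDim (Localization.AtPrime P) = d → ∀ s : Fin d → Localization.AtPrime P,
      (Ideal.span (Set.range s)).radical.IsMaximal →
        IsWeaklyRegular (Localization.AtPrime P) (List.ofFn s) := by
  have hPU : hU.fromSpec ⟨P, hP⟩ ∈ U := by
    rw [← SetLike.mem_coe, ← hU.range_fromSpec]
    exact ⟨⟨P, hP⟩, rfl⟩
  letI : Algebra Γ(X, U) (X.presheaf.stalk (hU.fromSpec ⟨P, hP⟩)) :=
    TopCat.Presheaf.algebra_section_stalk X.presheaf ⟨hU.fromSpec ⟨P, hP⟩, hPU⟩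
  haveI : IsLocalization.AtPrime (X.presheaf.stalk (hU.fromSpec ⟨P, hP⟩)) P :=
    hU.isLocalization_stalk' ⟨P, hP⟩ hPU
  exact cmClause_of_ringEquiv (IsLocalization.algEquiv P.primeCompl
    (X.presheaf.stalk (hU.fromSpec ⟨P, hP⟩)) (Localization.AtPrime P)).toRingEquiv
    (hCM _ hPU)

/-- **Affine pieces of a scheme locally of finite type over a field are finite type algebras**: for
`f : X → Spec k` locally of finite type and an affine open `U`, there is a `k`-algebra structure on
`Γ(X, U)` (namely `k ≅ Γ(Spec k, ⊤) → Γ(X, U)`, `Scheme.ΓSpecIso` and `Scheme.Hom.appLE`) of finite type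
(`Scheme.Hom.finiteType_appLE`). Stated as an existential over the algebra structure, which is all the
ring-level openness statement consumes. [folklore] -/
-- adapted from `FRationalResolution.exists_stalk_ringEquiv_quotient_exists_surjective` (StalkPresentation)
theorem finiteType_sections (k : Type) [Field k] {X : Scheme.{0}} (f : X ⟶ Spec (.of k))
    [LocallyOfFiniteType f] {U : X.Opens} (hU : IsAffineOpen U) :
    ∃ _ : Algebra k Γ(X, U), Algebra.FiniteType k Γ(X, U) := by
  have h1 : (f.appLE ⊤ U le_top).hom.FiniteType :=
    f.finiteType_appLE (isAffineOpen_top _) hU le_top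
  have h2 : (Scheme.ΓSpecIso (.of k)).inv.hom.FiniteType :=
    RingHom.FiniteType.of_surjective _
      (Scheme.ΓSpecIso (.of k)).symm.commRingCatIsoToRingEquiv.surjective
  let g : k →+* Γ(X, U) := (f.appLE ⊤ U le_top).hom.comp (Scheme.ΓSpecIso (.of k)).inv.hom
  have h3 : g.FiniteType := h1.comp h2
  letI : Algebra k Γ(X, U) := g.toAlgebra
  exact ⟨g.toAlgebra, RingHom.finiteType_algebraMap.mp h3⟩

/-! ## §4 The reduction of stub #2 to the ring-level openness statement -/

/-- **STUB #2 REDUCED TO THE RING LEVEL.** Let `p` be a prime and `k` a field of characteristic `p`.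
ASSUME the ring-level openness statement: for every `k`-algebra `R` of finite type all of whose local
rings `R_P` satisfy the Cohen–Macaulay clause, the set of primes `P` such that every parameter ideal of
`R_P` is Frobenius closed (inline form, exponent base `p`) is open in `Spec R` — this is Datta–Murayama
2024 Thm. B (`A = k`) combined with Lem. 2.6 loc. cit. (Cohen–Macaulay: F-injective ⇔ parameter ideals
Frobenius closed), to be supplied as a named fact or a proof. THEN the registered statement of
`stub_fiLocusOpen` holds for `p, k`: for `X₁ → Spec k` locally of finite type with Cohen–Macaulay stalks,
`{x | every parameter ideal of 𝒪_{X₁,x} is Frobenius closed}` is open. Proof: locality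
(`isOpen_setOf_stalk_of_affineOpens` with `C` = the Frobenius-closure clause, invariant by
`fClause_of_ringEquiv`), the hypothesis on each affine open `U` (`finiteType_sections`; Cohen–Macaulayness
of the `Γ(X₁, U)_P` by `cmClause_localization_of_stalks`). [folklore] -/
theorem fiLocusOpen_of_ringLevel (p : ℕ) (k : Type) [Field k]
    (H : ∀ (R : Type) [CommRing R] [Algebra k R], Algebra.FiniteType k R →
      (∀ (P : Ideal R) [P.IsPrime], ∀ d : ℕ, ringKrullDim (Localization.AtPrime P) = d →
        ∀ s : Fin d → Localization.AtPrime P, (Ideal.span (Set.range s)).radical.IsMaximal →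
          IsWeaklyRegular (Localization.AtPrime P) (List.ofFn s)) →
      IsOpen {P : PrimeSpectrum R | ∀ d : ℕ, ringKrullDim (Localization.AtPrime P.asIdeal) = d →
        ∀ s : Fin d → Localization.AtPrime P.asIdeal, (Ideal.span (Set.range s)).radical.IsMaximal →
          ∀ y : Localization.AtPrime P.asIdeal, (∃ e : ℕ, y ^ p ^ e ∈ Ideal.span
            ((fun z : Localization.AtPrime P.asIdeal => z ^ p ^ e) ''
              (Ideal.span (Set.range s) : Set (Localization.AtPrime P.asIdeal)))) →
            y ∈ Ideal.span (Set.range s)})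
    (X₁ : Scheme.{0}) (f₁ : X₁ ⟶ Spec (.of k)) (hf₁ : LocallyOfFiniteType f₁)
    (hCM : ∀ x : X₁, ∀ d : ℕ, ringKrullDim (X₁.presheaf.stalk x) = d →
      ∀ s : Fin d → X₁.presheaf.stalk x, (Ideal.span (Set.range s)).radical.IsMaximal →
        IsWeaklyRegular (X₁.presheaf.stalk x) (List.ofFn s)) :
    IsOpen {x : X₁ | ∀ d : ℕ, ringKrullDim (X₁.presheaf.stalk x) = d →
      ∀ s : Fin d → X₁.presheaf.stalk x, (Ideal.span (Set.range s)).radical.IsMaximal →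
        ∀ y : X₁.presheaf.stalk x, (∃ e : ℕ, y ^ p ^ e ∈ Ideal.span
          ((fun z : X₁.presheaf.stalk x => z ^ p ^ e) ''
            (Ideal.span (Set.range s) : Set (X₁.presheaf.stalk x)))) → y ∈ Ideal.span (Set.range s)} := by
  haveI := hf₁
  refine isOpen_setOf_stalk_of_affineOpens X₁
    (fun A _ => ∀ d : ℕ, ringKrullDim A = d → ∀ s : Fin d → A,
      (Ideal.span (Set.range s)).radical.IsMaximal →
        ∀ y : A, (∃ e : ℕ, y ^ p ^ e ∈ Ideal.span ((fun z : A => z ^ p ^ e) ''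
          (Ideal.span (Set.range s) : Set A))) → y ∈ Ideal.span (Set.range s))
    (fun A B _ _ e hA => fClause_of_ringEquiv p e hA) ?_
  intro U hU
  obtain ⟨_, hft⟩ := finiteType_sections k f₁ hU
  exact H Γ(X₁, U) hft (fun P _ => cmClause_localization_of_stalks hU (fun x _ => hCM x) P)

end Summit.ResolutionOfSingularities.ResolutionOfSingularities.Theorems.FInjectiveMacaulayfication.FiLocusOpenOfAffine

end
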